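/-
Copyright (c) 2026 the pub-hodgecm-mathlib formalisation cell (harness21).  Prover seat hodgecm-mathlib-K2E3-p12 (g3), Track B «K2-LIT» ∕ h413
(`stmt-HodgeConjecture-24833`), line `K2_E3_EllipticInputs`, unit U12-d, §L: THE STRUCTURE DEBT (a) `J(𝒩)(𝔤𝔩₂) = ℂδ₀ ⊕ ℂμ_reg` REDUCED TO UNIQUENESS ON THE
PUNCTURED CONE — an additive homogeneous functional that equals `c·M` on test functions vanishing near `x₀` equals `a·δ_{x₀} + c·M` everywhere.  2026-09-04.
-/
import Summits.HodgeConjecture.HodgeConjecture.Theorems.K2E3GLnNilpotentFourierPointSupport    -- ★ p856457 (this seat): `isOpen_isCompact_matrixIntegerBox`, `IsLocSmooth` kit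
import Summits.HodgeConjecture.HodgeConjecture.Theorems.K2E3GL2RegularNilpotentOrbitalMeasure   -- ★ p856734 (this seat): the `J(𝒩)` clauses of `μ_reg`
import HarnessLib

/-!
# K2_E3 road (h413), §L — structure of `J(𝒩)(𝔤𝔩₂(F))` from uniqueness on the punctured nilpotent cone

Cell `pub/hodgecm-mathlib` (D-0151), Track B, seat K2E3-p12 (g3), §L line lead (dealer K2E3-plan (g2), D20).  `--supports stmt-HodgeConjecture-24833 --as helper`;
THEOREMS ONLY (no definition ∕ instance ∕ notation ∕ named fact ∕ `sorry`); never imports `Cruxes/…/Lines`.  COUNT-NEUTRAL.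

★ p856788 `gl2_nilpotentFourierRegular_of_structure` reduces (L-B_GL) at `N = 2` to (a) STRUCTURE `hA` — every `T ∈ J(𝒩)(𝔤𝔩₂(F))` is `a·δ₀ + b·μ_reg` on
`C_c^∞` — and (b) regularity of `μ̂_reg`.  Harish-Chandra's proof of (a) [HarishChandra1999AdmissibleDistributions, §3, Thm. 3.9, Cor. 3.10; after Howe 1974
Prop. 2 and Bernstein–Zelevinsky 1976 §1.18] has two halves: (a-orb) on test functions vanishing near `0`, `T` is an invariant functional on `S(𝒪_reg)`,
`𝒪_reg = 𝒩 ∖ {0}` ONE `GL₂(F)`-orbit (★ `exists_glInt_conj_nilp_eq`), hence `c·μ_reg` there (uniqueness of invariant functionals on one orbit, ★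
`Literature.MeasureTheory.Group.exists_forall_apply_eq_const_mul_integral_of_smul_invariant_of_additive`); (a-pt) what is left is supported AT `0`, hence a
multiple of `δ₀`.  This file proves (a-pt) in general and packages «(a-orb) ⇒ (a)»:
* §1 **`apply_eq_delta_add_of_eq_off_point`** (any Hausdorff `X`, compact open `K₀ ∋ x₀`; `T`, `M` additive and homogeneous on `C_c^∞(X)`; `T = c·M` on the test
  functions with `x₀ ∉ tsupport`): `T f = (T(1_{K₀}) − c·M(1_{K₀}))·f(x₀) + c·M f` for every `f ∈ C_c^∞(X)` — the two-term refinement of ★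
  `apply_eq_apply_indicator_mul_of_notMem_tsupport` (case `M = 0`).
* §2 **`gl2_nilpotentStructure_of_puncturedCone`**: for `T` with the four `J(𝒩)` clauses of (L-B_GL) and `μ_reg` (★ p856734), IF `∃ c, T f = c·μ_reg(f)` for all
  `f ∈ C_c^∞(𝔤𝔩₂(F))` with `0 ∉ tsupport f`, THEN `∃ a b, ∀ f ∈ C_c^∞, T f = a·f(0) + b·μ_reg(f)` — LETTER FOR LETTER the hypothesis `hA` of ★ p856788 for this `T`.
So (a) = (a-orb) exactly; (a-orb) = ★ COINV-1 uniqueness on the orbit `𝒪_reg` (inputs in the tree: ★ Glimm–Effros `isOpenMap_smul_orbit_of_isLocallyClosed`, ★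
`exists_extend_zero_sdiff`, ★ p856734∕p856767∕p856815 for the invariant measure in the `K × F` chart) — not proved here.

References: [HarishChandra1999AdmissibleDistributions] Harish-Chandra (DeBacker–Sally), AMS ULECT 16 (1999), §3 pp. 8–10, Thm. 3.9, Cor. 3.10 · [Howe1974] R. Howe,
Math. Ann. 208 (1974), Prop. 2 · [BernsteinZelevinsky1976] Russian Math. Surveys 31:3 (1976), §1.18.
-/

set_option autoImplicit false
set_option linter.dupNamespace false   -- `Summit.HodgeConjecture.HodgeConjecture.…` (D-0017 nested layout; lakefile exemption for Summits)

noncomputable section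

open MeasureTheory Measure Filter Topology
open scoped MatrixGroups NNReal ENNReal
open Literature.NumberTheory.Rogawski1990 Literature.NumberTheory.Automorphic Literature.NumberTheory.Automorphic.LocalFieldHaar
open Literature.NumberTheory.GaloisRepresentations Literature.NumberTheory.GaloisRepresentations.IsNonarchimedeanLocalField
open Summit.HodgeConjecture.HodgeConjecture.Cruxes.H413.K2E3GLnNilpotentFourierPointSupport
open Summit.HodgeConjecture.HodgeConjecture.Cruxes.H413.K2E3GL2RegularNilpotentOrbitalMeasure

namespace Summit.HodgeConjecture.HodgeConjecture.Cruxes.H413.K2E3GL2NilpotentStructureOfPuncturedCone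

/-! ## §1  Functionals agreeing with `c·M` off a point -/

section OffPoint

variable {X : Type*} [TopologicalSpace X] [T2Space X]

/-- **`T = c·M` off `x₀` ⇒ `T = a·δ_{x₀} + c·M`.**  `X` Hausdorff, `K₀ ∋ x₀` compact open; `T`, `M` additive and homogeneous on `C_c^∞(X)`; `T f = c·M f` whenever
`x₀ ∉ tsupport f`.  Then `T f = (T(1_{K₀}) − c·M(1_{K₀}))·f(x₀) + c·M f` for every `f ∈ C_c^∞(X)`.  Proof: with `K₁ = K₀ ∩ f⁻¹{f(x₀)}` (compact open, `∋ x₀`),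
`f − f(x₀)·1_{K₁}` and `1_{K₀} − 1_{K₁}` vanish on `K₁`, so `T − c·M` kills both. [cite: HarishChandra1999AdmissibleDistributions, Thm. 3.9, Cor. 3.10 p. 10] -/
theorem apply_eq_delta_add_of_eq_off_point {x₀ : X} {K₀ : Set X} (hK₀o : IsOpen K₀) (hK₀c : IsCompact K₀) (hx₀ : x₀ ∈ K₀)
    (T M : (X → ℂ) → ℂ)
    (hTadd : ∀ f₁ f₂ : X → ℂ, IsLocSmooth f₁ → IsLocSmooth f₂ → T (f₁ + f₂) = T f₁ + T f₂)
    (hTsmul : ∀ (a : ℂ) (f : X → ℂ), IsLocSmooth f → T (a • f) = a * T f)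
    (hMadd : ∀ f₁ f₂ : X → ℂ, IsLocSmooth f₁ → IsLocSmooth f₂ → M (f₁ + f₂) = M f₁ + M f₂)
    (hMsmul : ∀ (a : ℂ) (f : X → ℂ), IsLocSmooth f → M (a • f) = a * M f)
    (c : ℂ) (hTM : ∀ f : X → ℂ, IsLocSmooth f → x₀ ∉ tsupport f → T f = c * M f)
    {f : X → ℂ} (hf : IsLocSmooth f) :
    T f = (T (K₀.indicator fun _ => (1 : ℂ)) - c * M (K₀.indicator fun _ => (1 : ℂ))) * f x₀ + c * M f := by
  -- the compact open `K₁ = K₀ ∩ f⁻¹{f x₀} ∋ x₀`, on which `f ≡ f x₀`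
  set K₁ : Set X := K₀ ∩ f ⁻¹' {f x₀} with hK₁
  have hK₁o : IsOpen K₁ := hK₀o.inter (hf.1.isOpen_fiber _)
  have hK₁c : IsCompact K₁ := hK₀c.inter_right (hf.1.isClosed_fiber _)
  have hx₁ : x₀ ∈ K₁ := ⟨hx₀, rfl⟩
  have h1K₀ : IsLocSmooth (K₀.indicator fun _ => (1 : ℂ)) := isLocSmooth_indicator hK₀o hK₀c.isClosed hK₀c
  have h1K₁ : IsLocSmooth (K₁.indicator fun _ => (1 : ℂ)) := isLocSmooth_indicator hK₁o hK₁c.isClosed hK₁c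
  -- a function vanishing on `K₁` has `x₀ ∉ tsupport`
  have hvan : ∀ g : X → ℂ, (∀ y ∈ K₁, g y = 0) → x₀ ∉ tsupport g := fun g hg =>
    notMem_tsupport_iff_eventuallyEq.2 (Filter.eventually_of_mem (hK₁o.mem_nhds hx₁) hg)
  -- (a) `(T − cM)(1_{K₀}) = (T − cM)(1_{K₁})`
  have ha : T (K₀.indicator fun _ => (1 : ℂ)) - c * M (K₀.indicator fun _ => (1 : ℂ)) =
      T (K₁.indicator fun _ => (1 : ℂ)) - c * M (K₁.indicator fun _ => (1 : ℂ)) := by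
    have hsplit : (K₀.indicator fun _ => (1 : ℂ)) = ((K₀.indicator fun _ => (1 : ℂ)) - K₁.indicator fun _ => (1 : ℂ)) + K₁.indicator fun _ => (1 : ℂ) :=
      (sub_add_cancel _ _).symm
    have hd : T ((K₀.indicator fun _ => (1 : ℂ)) - K₁.indicator fun _ => (1 : ℂ)) = c * M ((K₀.indicator fun _ => (1 : ℂ)) - K₁.indicator fun _ => (1 : ℂ)) :=
      hTM _ (h1K₀.sub h1K₁) (hvan _ fun y hy => by
        simp only [Pi.sub_apply, Set.indicator_of_mem hy.1, Set.indicator_of_mem hy, sub_self])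
    conv_lhs => rw [hsplit]
    rw [hTadd _ _ (h1K₀.sub h1K₁) h1K₁, hMadd _ _ (h1K₀.sub h1K₁) h1K₁, hd]
    ring
  -- (b) `T f = f(x₀)·T(1_{K₁}) + c·M(f − f(x₀)1_{K₁})`
  have hg : T (f - f x₀ • K₁.indicator fun _ => (1 : ℂ)) = c * M (f - f x₀ • K₁.indicator fun _ => (1 : ℂ)) :=
    hTM _ (hf.sub (h1K₁.const_smul _)) (hvan _ fun y hy => by
      have hy2 : f y = f x₀ := hy.2
      simp only [Pi.sub_apply, Pi.smul_apply, Set.indicator_of_mem hy, smul_eq_mul, mul_one, hy2, sub_self])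
  have hsplit : f = (f - f x₀ • K₁.indicator fun _ => (1 : ℂ)) + f x₀ • K₁.indicator fun _ => (1 : ℂ) := (sub_add_cancel _ _).symm
  have hTf : T f = c * M (f - f x₀ • K₁.indicator fun _ => (1 : ℂ)) + f x₀ * T (K₁.indicator fun _ => (1 : ℂ)) := by
    conv_lhs => rw [hsplit]
    rw [hTadd _ _ (hf.sub (h1K₁.const_smul _)) (h1K₁.const_smul _), hg, hTsmul _ _ h1K₁]
  have hMf : M (f - f x₀ • K₁.indicator fun _ => (1 : ℂ)) = M f - f x₀ * M (K₁.indicator fun _ => (1 : ℂ)) := by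
    have h := hMadd (f - f x₀ • K₁.indicator fun _ => (1 : ℂ)) (f x₀ • K₁.indicator fun _ => (1 : ℂ))
      (hf.sub (h1K₁.const_smul (f x₀))) (h1K₁.const_smul (f x₀))
    rw [← hsplit, hMsmul _ _ h1K₁] at h
    linear_combination -h
  rw [hTf, hMf, ha]
  ring

end OffPoint

/-! ## §2  `J(𝒩)(𝔤𝔩₂(F))`: structure from uniqueness on the punctured cone -/

section GL2

variable {F : Type*} [Field F] [ValuativeRel F] [TopologicalSpace F] [IsNonarchimedeanLocalField F]
  [MeasurableSpace F] [BorelSpace F] [MeasurableSpace (GL (Fin 2) F)] [BorelSpace (GL (Fin 2) F)]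
  (κ : Measure ↥(glInt 2 F)) [IsFiniteMeasureOnCompacts κ] (dx : Measure F) [IsFiniteMeasureOnCompacts dx]

/-- **(a) ⟸ (a-orb).**  Let `T` be additive and homogeneous on `C_c^∞(𝔤𝔩₂(F))` (clauses (i), (ii) of `J(𝒩)`; invariance and support are not even needed
here) and suppose `T = c·μ_reg` on the test functions vanishing near `0` (the conclusion of the one-orbit uniqueness on `𝒪_reg = 𝒩 ∖ {0}`).  Then
`T = a·δ₀ + b·μ_reg` on all of `C_c^∞(𝔤𝔩₂(F))` — the hypothesis `hA` of ★ `gl2_nilpotentFourierRegular_of_structure` for this `T`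
(`a = T(1_{𝒪^{2×2}}) − c·μ_reg(1_{𝒪^{2×2}})`, `b = c`). [cite: HarishChandra1999AdmissibleDistributions, Thm. 3.9, Cor. 3.10 p. 10] -/
theorem gl2_nilpotentStructure_of_puncturedCone (T : (Matrix (Fin 2) (Fin 2) F → ℂ) → ℂ)
    (hTadd : ∀ f₁ f₂ : Matrix (Fin 2) (Fin 2) F → ℂ, IsLocSmooth f₁ → IsLocSmooth f₂ → T (f₁ + f₂) = T f₁ + T f₂)
    (hTsmul : ∀ (a : ℂ) (f : Matrix (Fin 2) (Fin 2) F → ℂ), IsLocSmooth f → T (a • f) = a * T f)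
    (hU : ∃ c : ℂ, ∀ f : Matrix (Fin 2) (Fin 2) F → ℂ, IsLocSmooth f → (0 : Matrix (Fin 2) (Fin 2) F) ∉ tsupport f →
      T f = c * ∫ p : ↥(glInt 2 F) × F, f (((p.1 : GL (Fin 2) F) : Matrix (Fin 2) (Fin 2) F) * !![0, p.2; 0, 0] *
        ((((p.1 : GL (Fin 2) F))⁻¹ : GL (Fin 2) F) : Matrix (Fin 2) (Fin 2) F)) ∂(κ.prod dx)) :
    ∃ a b : ℂ, ∀ f : Matrix (Fin 2) (Fin 2) F → ℂ, IsLocSmooth f →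
      T f = a * f 0 + b * ∫ p : ↥(glInt 2 F) × F, f (((p.1 : GL (Fin 2) F) : Matrix (Fin 2) (Fin 2) F) * !![0, p.2; 0, 0] *
        ((((p.1 : GL (Fin 2) F))⁻¹ : GL (Fin 2) F) : Matrix (Fin 2) (Fin 2) F)) ∂(κ.prod dx) := by
  haveI : T2Space F := (isLocalField F).toT2Space
  obtain ⟨c, hc⟩ := hU
  obtain ⟨hΛo, hΛc, hΛ0⟩ := isOpen_isCompact_matrixIntegerBox (F := F) (N := 2)
  refine ⟨T ({X : Matrix (Fin 2) (Fin 2) F | ∀ i j, X i j ∈ primePowBall F 0}.indicator fun _ => (1 : ℂ)) -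
      c * ∫ p : ↥(glInt 2 F) × F, ({X : Matrix (Fin 2) (Fin 2) F | ∀ i j, X i j ∈ primePowBall F 0}.indicator fun _ => (1 : ℂ))
        (((p.1 : GL (Fin 2) F) : Matrix (Fin 2) (Fin 2) F) * !![0, p.2; 0, 0] * ((((p.1 : GL (Fin 2) F))⁻¹ : GL (Fin 2) F) : Matrix (Fin 2) (Fin 2) F)) ∂(κ.prod dx),
    c, fun f hf => ?_⟩
  have h := apply_eq_delta_add_of_eq_off_point hΛo hΛc hΛ0 T
    (fun g : Matrix (Fin 2) (Fin 2) F → ℂ => ∫ p : ↥(glInt 2 F) × F, g (((p.1 : GL (Fin 2) F) : Matrix (Fin 2) (Fin 2) F) * !![0, p.2; 0, 0] *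
        ((((p.1 : GL (Fin 2) F))⁻¹ : GL (Fin 2) F) : Matrix (Fin 2) (Fin 2) F)) ∂(κ.prod dx))
    hTadd hTsmul (fun f₁ f₂ h₁ h₂ => nilpotentAverage_add κ dx h₁ h₂) (fun a g _ => nilpotentAverage_smul κ dx a g) c hc hf
  rw [h]

end GL2

end Summit.HodgeConjecture.HodgeConjecture.Cruxes.H413.K2E3GL2NilpotentStructureOfPuncturedCone
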